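import Summits.AtomisticToContinuum.Crystallization.Theorems.SquareWellLayerCakeGapTwelveToBarlowUniformSpacingSelectionTemplate

/-!
# `stub_uniformSpacingSelection` (crux `GapTwelveToBarlow`, stmt-AtomisticToContinuum-15807), bridge side, VI:
# averaging over sub-blocks, re-centring a relaxed-matched window, density bookkeeping

Tools for the finite-`N` step (b1) of the hull ⇒ a.e. bridge (`uniformSpacingSelection-REPORT.md`):

* `sel_window_of_dense` (sub-block averaging): a set `M ⊆ [p, p+T]` with `2L ≤ T` meets some window
  `[μ − L, μ + L]`, `μ ∈ [p, p+T]`, in at least `#M (L+1)/(T+1)` points;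
* `sel_layeredPos_shift`, `sel_recentre`: the template of a two-way `(R', ε')`-matched window of `y i`,
  re-based at the site of the template point `(μ, i₀, j₀)`, is — after re-indexing the layers by `μ` and
  subtracting `z μ` (so that the new heights vanish at `0`) — a layered set in the vocabulary of
  `LayeredHull.stub_extraction`, two-way `2ε'`-matched on `‖·‖ ≤ n` by the translate `y − y j⋆`
  (`2|μ − m₀| + n + 1 ≤ R'`);
* `sel_bad_shift`: bad base layers are invariant under this re-indexing;
* `sel_theta_of_not_tendsto`, `sel_eventually_card_le`: the `Tendsto`/`Nat.card`
  bookkeeping turning the a.e. hypotheses into statements about finsets of sites at a fixed large `N`.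
-/

noncomputable section

namespace Summit.AtomisticToContinuum.Crystallization.Theorems.SquareWellLayerCakeGapTwelveToBarlow

open scoped BigOperators
open Filter Topology Literature.MathematicalPhysics.StatisticalMechanics
open Summit.AtomisticToContinuum.Crystallization.Theorems.LayeredHull


/-! ## Sub-block averaging -/

/-- **Sub-block averaging.** If `M ⊆ [p, p + T]` and `2L ≤ T`, some window `[μ − L, μ + L]` with
`μ ∈ [p, p + T]` contains at least `#M (L + 1) / (T + 1)` points of `M`. [folklore] -/
theorem sel_window_of_dense (M : Finset ℤ) (p : ℤ) (T L : ℕ) (hT : 2 * L ≤ T)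
    (hM : M ⊆ Finset.Icc p (p + T)) :
    ∃ μ ∈ Finset.Icc p (p + T),
      M.card * (L + 1) ≤ (T + 1) * (M.filter fun m => μ - L ≤ m ∧ m ≤ μ + L).card := by
  classical
  have hne : (Finset.Icc p (p + T)).Nonempty := ⟨p, Finset.mem_Icc.2 ⟨le_rfl, by omega⟩⟩
  obtain ⟨μ, hμ, hmax⟩ := Finset.exists_max_image (Finset.Icc p (p + T))
    (fun μ => (M.filter fun m => μ - L ≤ m ∧ m ≤ μ + L).card) hne
  refine ⟨μ, hμ, ?_⟩
  -- the double-counting sum over the windows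
  set S : ℕ := ∑ μ' ∈ Finset.Icc p (p + T), (M.filter fun m => μ' - L ≤ m ∧ m ≤ μ' + L).card with hS
  have hS1 : S ≤ (T + 1) * (M.filter fun m => μ - L ≤ m ∧ m ≤ μ + L).card := by
    have h := Finset.sum_le_card_nsmul _ _ _ hmax
    rw [Int.card_Icc, smul_eq_mul, show (p + T + 1 - p).toNat = T + 1 by omega] at h
    exact h
  -- swap: every `m ∈ M` lies in at least `L + 1` windows
  have hswap : S = ∑ m ∈ M, ((Finset.Icc p (p + T)).filter fun μ' => μ' - L ≤ m ∧ m ≤ μ' + L).card := by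
    rw [hS]
    simp only [Finset.card_filter]
    exact Finset.sum_comm
  have hS2 : M.card * (L + 1) ≤ S := by
    rw [hswap, ← smul_eq_mul]
    refine Finset.card_nsmul_le_sum _ _ _ fun m hm => ?_
    obtain ⟨h1, h2⟩ := Finset.mem_Icc.1 (hM hm)
    by_cases hup : m + L ≤ p + T
    · -- the windows based at `μ' ∈ [m, m + L]`
      have hsub : Finset.Icc m (m + L) ⊆
          (Finset.Icc p (p + T)).filter fun μ' => μ' - L ≤ m ∧ m ≤ μ' + L := by
        intro μ' hμ'
        obtain ⟨h3, h4⟩ := Finset.mem_Icc.1 hμ'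
        exact Finset.mem_filter.2 ⟨Finset.mem_Icc.2 ⟨by omega, by omega⟩, by omega, by omega⟩
      refine le_trans ?_ (Finset.card_le_card hsub)
      rw [Int.card_Icc]; omega
    · -- the windows based at `μ' ∈ [m − L, m]`
      have hsub : Finset.Icc (m - L) m ⊆
          (Finset.Icc p (p + T)).filter fun μ' => μ' - L ≤ m ∧ m ≤ μ' + L := by
        intro μ' hμ'
        obtain ⟨h3, h4⟩ := Finset.mem_Icc.1 hμ'
        exact Finset.mem_filter.2 ⟨Finset.mem_Icc.2 ⟨by omega, by omega⟩, by omega, by omega⟩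
      refine le_trans ?_ (Finset.card_le_card hsub)
      rw [Int.card_Icc]; omega
  exact hS2.trans hS1

/-! ## Re-centring a matched window -/

/-- **Re-indexed template.** Re-indexing the layers by `μ`, subtracting `z μ` and shifting the in-layer
indices by `(i₀, j₀)` gives the template offsets from the point `(μ, i₀, j₀)`. [folklore] -/
theorem sel_layeredPos_shift (a : ℝ) (s : ℤ → ℤ) (z : ℤ → ℝ) (μ i₀ j₀ m i j : ℤ) :
    layeredPos a (fun k => s (k + μ)) (fun k => z (k + μ) - z μ) m i j =
      layeredPos a s z (m + μ) (i + i₀) (j + j₀) - layeredPos a s z μ i₀ j₀ := by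
  rw [sel_layeredPos_sub_eq, sel_layeredPos_eq_layerVec, ext_haggLabel_shift, add_sub_cancel_right,
    add_sub_cancel_right]

/-- **Re-centring.** Let the `R'`-window of `y i` be two-way `ε'`-matched to the relaxed template
`(a, s, z, m₀, i₀, j₀, A)` (`47/50 ≤ a ≤ 1`, heights in the box), and `2|μ − m₀| + n + 1 ≤ R'`,
`ε' ≤ 1/2`.  Then for the site `j⋆` at the template point `(μ, i₀, j₀)`, the translate `y − y j⋆` is
two-way `2ε'`-matched on `‖·‖ ≤ n` with the layered set of the re-indexed data
`(A, a, s(· + μ), z(· + μ) − z μ)`. [folklore] -/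
theorem sel_recentre {N : ℕ} (y : Fin N → (EuclideanSpace ℝ (Fin 3))) (i : Fin N) {a : ℝ} (ha : 47 / 50 ≤ a) (ha1 : a ≤ 1)
    {s : ℤ → ℤ} (hs : IsHaggSeq s) {z : ℤ → ℝ}
    (hz : ∀ m : ℤ, 39 / 50 * a ≤ z (m + 1) - z m ∧ z (m + 1) - z m ≤ 17 / 20 * a)
    (A : (EuclideanSpace ℝ (Fin 3)) →ₗᵢ[ℝ] (EuclideanSpace ℝ (Fin 3))) (m₀ i₀ j₀ μ : ℤ) {R' ε' : ℝ} (n : ℕ) (hε1 : ε' ≤ 1 / 2)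
    (hμ : 2 * |(μ : ℝ) - m₀| + n + 1 ≤ R')
    (hW1 : ∀ m i' j' : ℤ, dist (layeredPos a s z m i' j') (layeredPos a s z m₀ i₀ j₀) ≤ R' →
      ∃ j₂ : Fin N, dist (y j₂) (y i + A (layeredPos a s z m i' j' - layeredPos a s z m₀ i₀ j₀)) ≤ ε')
    (hW2 : ∀ j₂ : Fin N, dist (y j₂) (y i) ≤ R' →
      ∃ m i' j' : ℤ, dist (y j₂) (y i + A (layeredPos a s z m i' j' - layeredPos a s z m₀ i₀ j₀)) ≤ ε') :
    ∃ t : (EuclideanSpace ℝ (Fin 3)),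
      (∀ p ∈ {p : (EuclideanSpace ℝ (Fin 3)) | ∃ m i j : ℤ, p = A (((i : ℝ) • triangularVec₁ a) + ((j : ℝ) • triangularVec₂ a) +
          ((haggLabel (fun k => s (k + μ)) m : ℝ) • barlowOffset a) + ((z (m + μ) - z μ) • layerNormal 1))},
        ‖p‖ ≤ n → ∃ j₂ : Fin N, dist (y j₂ + t) p ≤ 2 * ε') ∧
      (∀ j₂ : Fin N, ‖y j₂ + t‖ ≤ n → ∃ p ∈ {p : (EuclideanSpace ℝ (Fin 3)) | ∃ m i j : ℤ, p = A (((i : ℝ) • triangularVec₁ a) +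
          ((j : ℝ) • triangularVec₂ a) + ((haggLabel (fun k => s (k + μ)) m : ℝ) • barlowOffset a) +
          ((z (m + μ) - z μ) • layerNormal 1))}, dist (y j₂ + t) p ≤ 2 * ε') := by
  have habs : 0 ≤ |(μ : ℝ) - m₀| := abs_nonneg _
  -- the new base point and its site `j⋆`
  have hbase : dist (layeredPos a s z μ i₀ j₀) (layeredPos a s z m₀ i₀ j₀) ≤ 2 * |(μ : ℝ) - m₀| := by
    rw [dist_eq_norm]
    have := sel_norm_layeredPos_sub_le ha ha1 hs hz μ i₀ j₀ m₀ i₀ j₀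
    simp only [sub_self, abs_zero, zero_add] at this
    exact this
  obtain ⟨jst, hjst⟩ := hW1 μ i₀ j₀ (hbase.trans (by linarith))
  refine ⟨-y jst, fun p hp hpn => ?_, fun j₂ hj₂ => ?_⟩
  · -- (1) points of the re-indexed set near sites
    obtain ⟨m, i', j', rfl⟩ := hp
    have eP : ((i' : ℝ) • triangularVec₁ a) + ((j' : ℝ) • triangularVec₂ a) +
        ((haggLabel (fun k => s (k + μ)) m : ℝ) • barlowOffset a) + ((z (m + μ) - z μ) • layerNormal 1) =
        layeredPos a s z (m + μ) (i' + i₀) (j' + j₀) - layeredPos a s z μ i₀ j₀ := by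
      rw [← sel_layeredPos_shift]; rfl
    rw [eP] at hpn ⊢
    rw [A.norm_map] at hpn
    have hR' : dist (layeredPos a s z (m + μ) (i' + i₀) (j' + j₀)) (layeredPos a s z m₀ i₀ j₀) ≤ R' := by
      have h1 : dist (layeredPos a s z (m + μ) (i' + i₀) (j' + j₀)) (layeredPos a s z μ i₀ j₀) ≤ n := by
        rw [dist_eq_norm]; exact hpn
      have := dist_triangle (layeredPos a s z (m + μ) (i' + i₀) (j' + j₀)) (layeredPos a s z μ i₀ j₀)
        (layeredPos a s z m₀ i₀ j₀)
      linarith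
    obtain ⟨j₂, hj₂⟩ := hW1 (m + μ) (i' + i₀) (j' + j₀) hR'
    refine ⟨j₂, ?_⟩
    have e : y j₂ + -y jst - A (layeredPos a s z (m + μ) (i' + i₀) (j' + j₀) - layeredPos a s z μ i₀ j₀) =
        (y j₂ - (y i + A (layeredPos a s z (m + μ) (i' + i₀) (j' + j₀) - layeredPos a s z m₀ i₀ j₀))) -
          (y jst - (y i + A (layeredPos a s z μ i₀ j₀ - layeredPos a s z m₀ i₀ j₀))) := by
      rw [map_sub, map_sub, map_sub]; abel
    rw [dist_eq_norm, e]
    calc _ ≤ ‖y j₂ - (y i + A (layeredPos a s z (m + μ) (i' + i₀) (j' + j₀) - layeredPos a s z m₀ i₀ j₀))‖ +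
          ‖y jst - (y i + A (layeredPos a s z μ i₀ j₀ - layeredPos a s z m₀ i₀ j₀))‖ := norm_sub_le _ _
      _ ≤ ε' + ε' := by rw [← dist_eq_norm, ← dist_eq_norm]; exact add_le_add hj₂ hjst
      _ = 2 * ε' := by ring
  · -- (2) sites near points of the re-indexed set
    have hjst' : dist (y jst) (y i) ≤ 2 * |(μ : ℝ) - m₀| + ε' := by
      calc dist (y jst) (y i) ≤ dist (y jst) (y i + A (layeredPos a s z μ i₀ j₀ - layeredPos a s z m₀ i₀ j₀)) +
            dist (y i + A (layeredPos a s z μ i₀ j₀ - layeredPos a s z m₀ i₀ j₀)) (y i) := dist_triangle _ _ _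
        _ ≤ ε' + 2 * |(μ : ℝ) - m₀| := by
            refine add_le_add hjst ?_
            rwa [dist_eq_norm, add_sub_cancel_left, A.norm_map, ← dist_eq_norm]
        _ = _ := by ring
    have hR' : dist (y j₂) (y i) ≤ R' := by
      have h1 : dist (y j₂) (y jst) ≤ n := by rwa [dist_eq_norm, sub_eq_add_neg]
      have := dist_triangle (y j₂) (y jst) (y i)
      linarith
    obtain ⟨m, i', j', hm⟩ := hW2 j₂ hR'
    refine ⟨A (layeredPos a s z m i' j' - layeredPos a s z μ i₀ j₀), ⟨m - μ, i' - i₀, j' - j₀, ?_⟩, ?_⟩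
    · congr 1
      have := sel_layeredPos_shift a s z μ i₀ j₀ (m - μ) (i' - i₀) (j' - j₀)
      rw [sub_add_cancel, sub_add_cancel, sub_add_cancel] at this
      rw [← this]; rfl
    · have e : y j₂ + -y jst - A (layeredPos a s z m i' j' - layeredPos a s z μ i₀ j₀) =
          (y j₂ - (y i + A (layeredPos a s z m i' j' - layeredPos a s z m₀ i₀ j₀))) -
            (y jst - (y i + A (layeredPos a s z μ i₀ j₀ - layeredPos a s z m₀ i₀ j₀))) := by
        rw [map_sub, map_sub, map_sub]; abel
      rw [dist_eq_norm, e]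
      calc _ ≤ ‖y j₂ - (y i + A (layeredPos a s z m i' j' - layeredPos a s z m₀ i₀ j₀))‖ +
            ‖y jst - (y i + A (layeredPos a s z μ i₀ j₀ - layeredPos a s z m₀ i₀ j₀))‖ := norm_sub_le _ _
        _ ≤ ε' + ε' := by rw [← dist_eq_norm, ← dist_eq_norm]; exact add_le_add hm hjst
        _ = 2 * ε' := by ring

/-- **Bad layers are invariant under re-indexing.** [folklore] -/
theorem sel_bad_shift {z : ℤ → ℝ} {μ m : ℤ} {K δ : ℝ}
    (hbad : ¬ ∃ h : ℝ, ∀ m' : ℤ, |(m' : ℝ) - m| ≤ K → |z m' - z m - ((m' : ℝ) - m) * h| ≤ δ) :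
    ¬ ∃ h : ℝ, ∀ m' : ℤ, |(m' : ℝ) - (m - μ : ℤ)| ≤ K →
      |(z (m' + μ) - z μ) - (z ((m - μ : ℤ) + μ) - z μ) - ((m' : ℝ) - (m - μ : ℤ)) * h| ≤ δ := by
  rintro ⟨h, hh⟩
  apply hbad
  refine ⟨h, fun m' hm' => ?_⟩
  have := hh (m' - μ) (by push_cast; rw [show (m' : ℝ) - μ - (m - μ) = m' - m by ring]; exact hm')
  rw [sub_add_cancel, sub_add_cancel] at this
  push_cast at this
  rw [show (m' : ℝ) - μ - (m - μ) = m' - m by ring] at this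
  rwa [show z m' - z μ - (z m - z μ) = z m' - z m by ring] at this

/-! ## Density bookkeeping -/

/-- A nonnegative sequence that does not tend to `0` is frequently above a positive level. [folklore] -/
theorem sel_theta_of_not_tendsto (f : ℕ → ℝ) (hf : ∀ N, 0 ≤ f N) (h : ¬ Tendsto f atTop (𝓝 0)) :
    ∃ θ : ℝ, 0 < θ ∧ ∃ᶠ N in atTop, θ ≤ f N := by
  by_contra H
  push Not at H
  apply h
  rw [tendsto_order]
  exact ⟨fun b hb => Eventually.of_forall fun N => hb.trans_le (hf N), fun b hb => H b hb⟩

/-- A density tending to `0` is eventually below `κ N`. [folklore] -/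
theorem sel_eventually_card_le (g : ℕ → ℕ) (h : Tendsto (fun N : ℕ => (g N : ℝ) / N) atTop (𝓝 0))
    {κ : ℝ} (hκ : 0 < κ) : ∀ᶠ N in atTop, (g N : ℝ) ≤ κ * N := by
  have h1 : ∀ᶠ N : ℕ in atTop, (g N : ℝ) / N < κ := (tendsto_order.1 h).2 κ hκ
  refine (h1.and (eventually_ge_atTop 1)).mono fun N ⟨hN, hN1⟩ => ?_
  have hNpos : (0 : ℝ) < N := by exact_mod_cast hN1
  rw [div_lt_iff₀ hNpos] at hN
  exact hN.le

/-- **Anchor (registered sub-goal form of `sel_window_of_dense`, closed statement):** sub-block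
averaging. [folklore] -/
theorem stub_windowOfDense :
    ∀ (M : Finset ℤ) (p : ℤ) (T L : ℕ), 2 * L ≤ T → M ⊆ Finset.Icc p (p + T) →
      ∃ μ ∈ Finset.Icc p (p + T),
        M.card * (L + 1) ≤ (T + 1) * (M.filter fun m => μ - L ≤ m ∧ m ≤ μ + L).card :=
  fun M p T L hT hM => sel_window_of_dense M p T L hT hM

end Summit.AtomisticToContinuum.Crystallization.Theorems.SquareWellLayerCakeGapTwelveToBarlow

end
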